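import Literature.AlgebraicGeometry.Frobenioids.CoprimarySteps
import Literature.AlgebraicGeometry.Frobenioids.CoAngular
import Literature.AlgebraicGeometry.Frobenioids.Thm49FunctorialPullbacks
import HarnessLib

/-!
# [FrdI] Theorem 4.9: propagation of the divisor transport `Div φ ↦ Div Ψφ` along pre-steps

Mochizuki, *The geometry of Frobenioids I: the general theory*, Kyushu J. Math. **62** (2008)
293–400, §4, proof of Theorem 4.9, kurims text p. 89 ll. 10–33 [cite: MochizukiFrdI2008, Thm. 4.9 p.89]:

> "if the right-hand and left-hand isomorphisms of Theorem 4.2, (iii), coincide for all universally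
> Div-Frobenius-trivial objects, then it follows immediately from the construction of the isomorphism
> of functors `Ψ^Prime` in the proof of Theorem 4.2, (ii), that `Ψ^Prime` extends, for
> `A_i ∈ Ob(C_i^bs-iso)` …, to an isomorphism of monoids `Φ₁(A₁)^pf_𝔭₁ ⥲ Φ₂(A₂)^pf_𝔭₂` which is
> functorial in `A₁` … Moreover, by applying … Definition 1.3, (iii), (d), to obtain pre-steps
> `φ : A → B` of `C_i` with arbitrary prescribed zero divisor … one concludes immediately that this
> maps the subset `Φ₁(A₁)` … onto the subset `Φ₂(A₂)`".

PROOF-ONLY file (seat abc-iut-w4-d105; D-0068 sub-DAG S5, helper for row `FrdI:Thm4.9/T49-L02`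
`FrdI.T49.SufficesRightEqLeft`, whose kernel reduction
`FrdI.T49.sufficesRightEqLeft_conclusion_of_forall_exists` (seat abc-iut-w4-d035) consumes, at EVERY
object `A`, a multiplicative divisor transport `T_A : Φ₁(A) → Φ₂(ΨA)`, `Div φ ↦ Div Ψφ`; at
(universally) Div-Frobenius-trivial `A` this is `DivisorMonoidIsoDivFrobTrivial.lean`, seat
abc-iut-w4-d099). This file isolates how MULTIPLICATIVITY of such a transport moves between objects,
for any functor `G` carrying pre-steps to pre-steps and any family of FUNCTIONS `T_A` with the
pre-step clause `T_A(Div φ) = Div(Gφ)`: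

* `divTransport_comp_eq` — the composite identity `T_X(ψ^*y · Div ψ) = (Gψ)^* T_A(y) · Div Gψ` for a
  pre-step `ψ : X → A` (Rem. 1.1.1 on `φ_y ∘ ψ` and on its image; Def. 1.3 (iii)(d));
* `divTransport_pull_eq_of_mul_source`, `divTransport_mul_of_mul_source` — FORWARD propagation: if
  `T_X` is multiplicative then `T` is natural along every pre-step `ψ : X → A` out of `X` and `T_A` is
  multiplicative (the converse direction of `PreFrobenioid.pull_natural_of_isPreStep`, which assumes
  monoid homomorphisms);
* `divTransport_pull_eq_of_dvd`, `divTransport_pull_eq_of_dvd'` — BACKWARD, under "right-hand =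
  left-hand at `A`" in the form `(Gζ)^* T_A(x_ζ) = Div Gζ` for pre-steps `ζ : Y → A` (`x_ζ = invDiv ζ`,
  the left-hand prescription) and `T_A` multiplicative: along a pre-step `φ : X → A`, `T_X` agrees
  with the transported map `(Gφ)^* ∘ T_A ∘ (φ^*)⁻¹` on every element DIVIDING or DIVISIBLE BY `Div φ`;
* `divTransport_mul_of_cover` — hence `T_X` is multiplicative as soon as every `w ∈ Φ₁(X)` is
  comparable with `Div φ` for some pre-step `φ` from `X` into such an object `A`;
* `divTransport_mul_of_pullback_source` — DESCENT along pull-back morphisms `α : A' → A`: `T_{A'}`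
  multiplicative ⇒ `T_A` multiplicative (naturality along `α`, `PreFrobenioid.pull_natural_of_isPullbackMorphism`
  of seat abc-iut-w4-d035, and injectivity of `Base(Gα)^*`, Def. 1.1 (ii)(a)) — so, `C₁` being of rational
  type (Def. 4.5 (ii)/(iii)), only strictly rational objects need to be treated (cf. p. 89 ll. 41–46).

So the "for every `A`" clause of p. 89 reduces to: every object receives a pre-step from, or is
"comparably covered" by pre-steps into, objects where right-hand = left-hand holds (or a chain of
such). No new definitions; nothing of [FrdI] is restated; nothing here bears on [IUTchIII].
-/

namespace Literature.AlgebraicGeometry.Frobenioids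

open CategoryTheory Opposite

universe w v v' u u'

namespace PreFrobenioid

variable {D₁ : Type u} [Category.{v} D₁] {Φ₁ : D₁ᵒᵖ ⥤ CommMonCat.{w}} {C₁ : Type u'} [Category.{v'} C₁]
  {D₂ : Type u} [Category.{v} D₂] {Φ₂ : D₂ᵒᵖ ⥤ CommMonCat.{w}} {C₂ : Type u'} [Category.{v'} C₂]
  {F₁ : C₁ ⥤ ElemFrobenioid Φ₁} {F₂ : C₂ ⥤ ElemFrobenioid Φ₂}

/-- **The composite identity.** For a functor `G` carrying pre-steps to pre-steps, a family of
functions `T_A : Φ₁(A) → Φ₂(GA)` with `T_A(Div φ) = Div(Gφ)` on pre-steps, a pre-step `ψ : X → A`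
and `y ∈ Φ₁(A)`: `T_X(ψ^* y · Div ψ) = (Gψ)^* T_A(y) · Div(Gψ)` — Rem. 1.1.1 applied to `φ_y ∘ ψ`,
`Div φ_y = y` (Def. 1.3 (iii)(d)), and to its image under `G`.
[cite: MochizukiFrdI2008, Thm. 4.9 p.89] -/
theorem divTransport_comp_eq (hF₁ : IsFrobenioid F₁) (G : C₁ ⥤ C₂)
    (hG : ∀ ⦃X Y : C₁⦄ (φ : X ⟶ Y), IsPreStep F₁ φ → IsPreStep F₂ (G.map φ))
    (T : ∀ A : C₁, Φ₁.obj (op (baseObj F₁ A)) → Φ₂.obj (op (baseObj F₂ (G.obj A))))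
    (hT : ∀ ⦃A B : C₁⦄ (φ : A ⟶ B), IsPreStep F₁ φ → T A (Div F₁ φ) = Div F₂ (G.map φ))
    {X A : C₁} (ψ : X ⟶ A) (hψ : IsPreStep F₁ ψ) (y : Φ₁.obj (op (baseObj F₁ A))) :
    T X (pull Φ₁ (Base F₁ ψ) y * Div F₁ ψ) =
      pull Φ₂ (Base F₂ (G.map ψ)) (T A y) * Div F₂ (G.map ψ) := by
  obtain ⟨B, φ, hφ, hφy⟩ := hF₁.iii_d_under_surj A y
  have h1 : Div F₁ (ψ ≫ φ) = pull Φ₁ (Base F₁ ψ) y * Div F₁ ψ := by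
    rw [div_comp, hφy, show degFr F₁ φ = 1 from hφ.2.1, PNat.one_coe, pow_one]
  have h2 : Div F₂ (G.map (ψ ≫ φ)) =
      pull Φ₂ (Base F₂ (G.map ψ)) (Div F₂ (G.map φ)) * Div F₂ (G.map ψ) := by
    rw [G.map_comp, div_comp, show degFr F₂ (G.map φ) = 1 from (hG φ hφ.2).1, PNat.one_coe,
      pow_one]
  rw [← h1, hT _ (IsPreStep.comp F₁ hψ hφ.2), h2, ← hT φ hφ.2, hφy]

/-- **Forward propagation, naturality.** If `T_X` is multiplicative, then `T` is natural along every
pre-step `ψ : X → A` out of `X`: `T_X(ψ^* y) = (Gψ)^* T_A(y)` (from `divTransport_comp_eq`, the clause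
`T_X(Div ψ) = Div Gψ`, and cancellation in the divisorial monoid `Φ₂(GX)`).
[cite: MochizukiFrdI2008, Thm. 4.9 p.89] -/
theorem divTransport_pull_eq_of_mul_source (hF₁ : IsFrobenioid F₁) (hF₂ : IsFrobenioid F₂)
    (G : C₁ ⥤ C₂) (hG : ∀ ⦃X Y : C₁⦄ (φ : X ⟶ Y), IsPreStep F₁ φ → IsPreStep F₂ (G.map φ))
    (T : ∀ A : C₁, Φ₁.obj (op (baseObj F₁ A)) → Φ₂.obj (op (baseObj F₂ (G.obj A))))
    (hT : ∀ ⦃A B : C₁⦄ (φ : A ⟶ B), IsPreStep F₁ φ → T A (Div F₁ φ) = Div F₂ (G.map φ))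
    {X A : C₁} (ψ : X ⟶ A) (hψ : IsPreStep F₁ ψ) (hmul : ∀ a b, T X (a * b) = T X a * T X b)
    (y : Φ₁.obj (op (baseObj F₁ A))) :
    T X (pull Φ₁ (Base F₁ ψ) y) = pull Φ₂ (Base F₂ (G.map ψ)) (T A y) := by
  haveI : IsCancelMul (Φ₂.obj (op (baseObj F₂ (G.obj X)))) :=
    isIntegral_iff_isCancelMul.mp (hF₂.isPreFrobenioid.isDivisorial _).isPreDivisorial.isIntegral
  have key := divTransport_comp_eq hF₁ G hG T hT ψ hψ y
  rw [hmul, hT ψ hψ] at key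
  exact mul_right_cancel key

/-- **Forward propagation, multiplicativity.** If `T_X` is multiplicative and `ψ : X → A` is a
pre-step, then `T_A` is multiplicative: `(Gψ)^*` is injective (`Gψ` is a base-isomorphism) and
`(Gψ)^* ∘ T_A = T_X ∘ ψ^*` is a composite of multiplicative maps.
[cite: MochizukiFrdI2008, Thm. 4.9 p.89] -/
theorem divTransport_mul_of_mul_source (hF₁ : IsFrobenioid F₁) (hF₂ : IsFrobenioid F₂)
    (G : C₁ ⥤ C₂) (hG : ∀ ⦃X Y : C₁⦄ (φ : X ⟶ Y), IsPreStep F₁ φ → IsPreStep F₂ (G.map φ))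
    (T : ∀ A : C₁, Φ₁.obj (op (baseObj F₁ A)) → Φ₂.obj (op (baseObj F₂ (G.obj A))))
    (hT : ∀ ⦃A B : C₁⦄ (φ : A ⟶ B), IsPreStep F₁ φ → T A (Div F₁ φ) = Div F₂ (G.map φ))
    {X A : C₁} (ψ : X ⟶ A) (hψ : IsPreStep F₁ ψ) (hmul : ∀ a b, T X (a * b) = T X a * T X b)
    (y y' : Φ₁.obj (op (baseObj F₁ A))) : T A (y * y') = T A y * T A y' := by
  haveI : IsIso (Base F₂ (G.map ψ)) := (hG ψ hψ).2
  apply pull_injective_of_isIso Φ₂ (Base F₂ (G.map ψ))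
  rw [map_mul, ← divTransport_pull_eq_of_mul_source hF₁ hF₂ G hG T hT ψ hψ hmul y,
    ← divTransport_pull_eq_of_mul_source hF₁ hF₂ G hG T hT ψ hψ hmul y',
    ← divTransport_pull_eq_of_mul_source hF₁ hF₂ G hG T hT ψ hψ hmul (y * y'), map_mul, hmul]

/-- **Backward comparison on divisors of `Div φ`.** Let `φ : X → A` be a pre-step into an object `A`
at which `T_A` is multiplicative and "right-hand = left-hand" holds, i.e. `(Gζ)^* T_A(x_ζ) = Div(Gζ)`
for every pre-step `ζ : Y → A` (`x_ζ = (ζ^*)⁻¹ Div ζ`, Def. 1.3 (iii)(d)). Then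
`T_X(φ^* y) = (Gφ)^* T_A(y)` whenever `φ^* y` divides `Div φ`: factor `φ = ζ ∘ φ_w` through the
pre-step `φ_w` with `Div φ_w = w := φ^* y` (Def. 1.3 (iii)(d)), so that `x_φ = x_ζ · y`, and compare the
two evaluations of `T_X(Div φ) = Div Gφ` (isotropic type: every arrow of `C₁` is co-angular).
[cite: MochizukiFrdI2008, Thm. 4.9 p.89] -/
theorem divTransport_pull_eq_of_dvd (hF₁ : IsFrobenioid F₁) (hF₂ : IsFrobenioid F₂)
    (histr₁ : IsOfIsotropicType F₁) (G : C₁ ⥤ C₂)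
    (hG : ∀ ⦃X Y : C₁⦄ (φ : X ⟶ Y), IsPreStep F₁ φ → IsPreStep F₂ (G.map φ))
    (T : ∀ A : C₁, Φ₁.obj (op (baseObj F₁ A)) → Φ₂.obj (op (baseObj F₂ (G.obj A))))
    (hT : ∀ ⦃A B : C₁⦄ (φ : A ⟶ B), IsPreStep F₁ φ → T A (Div F₁ φ) = Div F₂ (G.map φ))
    {X A : C₁} (φ : X ⟶ A) (hφ : IsPreStep F₁ φ) (hmulA : ∀ a b, T A (a * b) = T A a * T A b)
    (hleft : ∀ ⦃Y : C₁⦄ (ζ : Y ⟶ A) (hζ : IsPreStep F₁ ζ),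
      pull Φ₂ (Base F₂ (G.map ζ)) (T A (invDiv F₁ ζ hζ.2)) = Div F₂ (G.map ζ))
    (y : Φ₁.obj (op (baseObj F₁ A))) (hdvd : pull Φ₁ (Base F₁ φ) y ∣ Div F₁ φ) :
    T X (pull Φ₁ (Base F₁ φ) y) = pull Φ₂ (Base F₂ (G.map φ)) (T A y) := by
  haveI : IsCancelMul (Φ₂.obj (op (baseObj F₂ (G.obj X)))) :=
    isIntegral_iff_isCancelMul.mp (hF₂.isPreFrobenioid.isDivisorial _).isPreDivisorial.isIntegral
  have hco₁ : ∀ {X Y : C₁} (f : X ⟶ Y), IsCoAngular F₁ f :=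
    fun f => isCoAngular_of_isIsotropic_codomains F₁ f fun Z _ => histr₁ Z
  -- the pre-step `φw` out of `X` with zero divisor `w := φ^* y`, and the factorisation `φ = ζ ∘ φw`
  obtain ⟨Xw, φw, hφw, hφww⟩ := hF₁.iii_d_under_surj X (pull Φ₁ (Base F₁ φ) y)
  obtain ⟨ζ, hζ, hfac⟩ := hF₁.iii_d_under_full φw φ hφw ⟨hco₁ φ, hφ⟩ (hφww ▸ hdvd)
  -- `φ^* x_ζ = φw^* Div ζ` and `Div φ = φw^* Div ζ · Div φw`
  have hpa : pull Φ₁ (Base F₁ φ) (invDiv F₁ ζ hζ.2.2) = pull Φ₁ (Base F₁ φw) (Div F₁ ζ) := by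
    rw [← hfac]; exact pull_base_comp_invDiv φw ζ hζ.2.2
  have hd : Div F₁ φ = pull Φ₁ (Base F₁ φw) (Div F₁ ζ) * Div F₁ φw := by
    rw [← hfac, div_comp, show degFr F₁ ζ = 1 from hζ.2.1, PNat.one_coe, pow_one]
  -- hence `x_φ = x_ζ · y`
  have hinv : invDiv F₁ φ hφ.2 = invDiv F₁ ζ hζ.2.2 * y := by
    haveI : IsIso (Base F₁ φ) := hφ.2
    apply pull_injective_of_isIso Φ₁ (Base F₁ φ)
    rw [pull_invDiv, map_mul, hpa, hd, hφww]
  -- first evaluation of `T_X(Div φ) = Div Gφ = Div (Gζ ∘ Gφw)`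
  have hGfac : G.map φw ≫ G.map ζ = G.map φ := by rw [← G.map_comp, hfac]
  have e1 : T X (Div F₁ φ) =
      pull Φ₂ (Base F₂ (G.map φ)) (T A (invDiv F₁ ζ hζ.2.2)) * T X (Div F₁ φw) := by
    rw [hT φ hφ, hT φw hφw.2, ← hGfac, div_comp,
      show degFr F₂ (G.map ζ) = 1 from (hG ζ hζ.2).1, PNat.one_coe, pow_one, ← hleft ζ hζ.2,
      ← pull_comp, ← base_comp]
  -- second evaluation, through `x_φ = x_ζ · y` and right-hand = left-hand for `φ`
  have e2 : T X (Div F₁ φ) = pull Φ₂ (Base F₂ (G.map φ)) (T A (invDiv F₁ ζ hζ.2.2)) *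
      pull Φ₂ (Base F₂ (G.map φ)) (T A y) := by
    rw [hT φ hφ, ← hleft φ hφ, hinv, hmulA, map_mul]
  have h := e1.symm.trans e2
  rw [hφww] at h
  exact mul_left_cancel h

/-- **Backward comparison on multiples of `Div φ`.** With `φ : X → A` a pre-step, `T_A` multiplicative
and right-hand = left-hand for `φ` itself (`(Gφ)^* T_A(x_φ) = Div Gφ`): `T_X(φ^* y) = (Gφ)^* T_A(y)`
whenever `Div φ` divides `φ^* y` — write `φ^* y = φ^* y' · Div φ`, i.e. `y = x_φ · y'`, and apply
`divTransport_comp_eq`. [cite: MochizukiFrdI2008, Thm. 4.9 p.89] -/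
theorem divTransport_pull_eq_of_dvd' (hF₁ : IsFrobenioid F₁) (G : C₁ ⥤ C₂)
    (hG : ∀ ⦃X Y : C₁⦄ (φ : X ⟶ Y), IsPreStep F₁ φ → IsPreStep F₂ (G.map φ))
    (T : ∀ A : C₁, Φ₁.obj (op (baseObj F₁ A)) → Φ₂.obj (op (baseObj F₂ (G.obj A))))
    (hT : ∀ ⦃A B : C₁⦄ (φ : A ⟶ B), IsPreStep F₁ φ → T A (Div F₁ φ) = Div F₂ (G.map φ))
    {X A : C₁} (φ : X ⟶ A) (hφ : IsPreStep F₁ φ) (hmulA : ∀ a b, T A (a * b) = T A a * T A b)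
    (hleftφ : pull Φ₂ (Base F₂ (G.map φ)) (T A (invDiv F₁ φ hφ.2)) = Div F₂ (G.map φ))
    (y : Φ₁.obj (op (baseObj F₁ A))) (hdvd : Div F₁ φ ∣ pull Φ₁ (Base F₁ φ) y) :
    T X (pull Φ₁ (Base F₁ φ) y) = pull Φ₂ (Base F₂ (G.map φ)) (T A y) := by
  haveI : IsIso (Base F₁ φ) := hφ.2
  obtain ⟨u, hu⟩ := hdvd
  -- `u = φ^* y'` with `y' := (φ^*)⁻¹ u`, and `y = x_φ · y'`
  have hy' : pull Φ₁ (Base F₁ φ) (pull Φ₁ (inv (Base F₁ φ)) u) = u := by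
    rw [← pull_comp, IsIso.hom_inv_id, pull_id]
  have hy : y = invDiv F₁ φ hφ.2 * pull Φ₁ (inv (Base F₁ φ)) u := by
    apply pull_injective_of_isIso Φ₁ (Base F₁ φ)
    rw [map_mul, pull_invDiv, hy', ← hu]
  have key := divTransport_comp_eq hF₁ G hG T hT φ hφ (pull Φ₁ (inv (Base F₁ φ)) u)
  rw [hy', ← hleftφ, ← map_mul, ← hmulA, mul_comm (pull Φ₁ (inv (Base F₁ φ)) u), ← hy] at key
  rw [hu, mul_comm]
  exact key

/-- **Comparable coverage forces multiplicativity.** Let `X` be an object of a Frobenioid of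
isotropic type such that every `w ∈ Φ₁(X)` is comparable (`w ∣ Div φ` or `Div φ ∣ w`) with the zero
divisor of some pre-step `φ : X → A` into an object `A` at which `T_A` is multiplicative and
right-hand = left-hand holds. Then `T_X` is multiplicative: by the two backward comparisons `T_X`
agrees with the transported multiplicative map `(Gφ)^* ∘ T_A ∘ (φ^*)⁻¹` on the elements comparable with
`Div φ`, and any two such transported maps coincide (they agree with `T_X` on the common multiples of
the two zero divisors; cancellation). [cite: MochizukiFrdI2008, Thm. 4.9 p.89] -/
theorem divTransport_mul_of_cover (hF₁ : IsFrobenioid F₁) (hF₂ : IsFrobenioid F₂)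
    (histr₁ : IsOfIsotropicType F₁) (G : C₁ ⥤ C₂)
    (hG : ∀ ⦃X Y : C₁⦄ (φ : X ⟶ Y), IsPreStep F₁ φ → IsPreStep F₂ (G.map φ))
    (T : ∀ A : C₁, Φ₁.obj (op (baseObj F₁ A)) → Φ₂.obj (op (baseObj F₂ (G.obj A))))
    (hT : ∀ ⦃A B : C₁⦄ (φ : A ⟶ B), IsPreStep F₁ φ → T A (Div F₁ φ) = Div F₂ (G.map φ))
    (X : C₁)
    (hcover : ∀ w : Φ₁.obj (op (baseObj F₁ X)), ∃ (A : C₁) (φ : X ⟶ A) (_ : IsPreStep F₁ φ),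
      (∀ a b, T A (a * b) = T A a * T A b) ∧
      (∀ ⦃Y : C₁⦄ (ζ : Y ⟶ A) (hζ : IsPreStep F₁ ζ),
        pull Φ₂ (Base F₂ (G.map ζ)) (T A (invDiv F₁ ζ hζ.2)) = Div F₂ (G.map ζ)) ∧
      (w ∣ Div F₁ φ ∨ Div F₁ φ ∣ w)) :
    ∀ a b : Φ₁.obj (op (baseObj F₁ X)), T X (a * b) = T X a * T X b := by
  haveI : IsCancelMul (Φ₂.obj (op (baseObj F₂ (G.obj X)))) :=
    isIntegral_iff_isCancelMul.mp (hF₂.isPreFrobenioid.isDivisorial _).isPreDivisorial.isIntegral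
  -- the transported value along a "good" pre-step `φ : X → A`, at `φ^* y`
  -- (1) agreement of `T_X` with the transport on comparable elements
  have step : ∀ {A : C₁} (φ : X ⟶ A) (hφ : IsPreStep F₁ φ),
      (∀ a b, T A (a * b) = T A a * T A b) →
      (∀ ⦃Y : C₁⦄ (ζ : Y ⟶ A) (hζ : IsPreStep F₁ ζ),
        pull Φ₂ (Base F₂ (G.map ζ)) (T A (invDiv F₁ ζ hζ.2)) = Div F₂ (G.map ζ)) →
      ∀ y, (pull Φ₁ (Base F₁ φ) y ∣ Div F₁ φ ∨ Div F₁ φ ∣ pull Φ₁ (Base F₁ φ) y) →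
        T X (pull Φ₁ (Base F₁ φ) y) = pull Φ₂ (Base F₂ (G.map φ)) (T A y) := by
    intro A φ hφ hmulA hleft y hcmp
    rcases hcmp with h | h
    · exact divTransport_pull_eq_of_dvd hF₁ hF₂ histr₁ G hG T hT φ hφ hmulA hleft y h
    · exact divTransport_pull_eq_of_dvd' hF₁ G hG T hT φ hφ hmulA (hleft φ hφ) y h
  -- (2) any two transports agree everywhere
  have agree : ∀ {A A' : C₁} (φ : X ⟶ A) (hφ : IsPreStep F₁ φ) (φ' : X ⟶ A')
      (hφ' : IsPreStep F₁ φ'),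
      (∀ a b, T A (a * b) = T A a * T A b) →
      (∀ ⦃Y : C₁⦄ (ζ : Y ⟶ A) (hζ : IsPreStep F₁ ζ),
        pull Φ₂ (Base F₂ (G.map ζ)) (T A (invDiv F₁ ζ hζ.2)) = Div F₂ (G.map ζ)) →
      (∀ a b, T A' (a * b) = T A' a * T A' b) →
      (∀ ⦃Y : C₁⦄ (ζ : Y ⟶ A') (hζ : IsPreStep F₁ ζ),
        pull Φ₂ (Base F₂ (G.map ζ)) (T A' (invDiv F₁ ζ hζ.2)) = Div F₂ (G.map ζ)) →
      ∀ y y', pull Φ₁ (Base F₁ φ) y = pull Φ₁ (Base F₁ φ') y' →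
        pull Φ₂ (Base F₂ (G.map φ)) (T A y) = pull Φ₂ (Base F₂ (G.map φ')) (T A' y') := by
    intro A A' φ hφ φ' hφ' hmulA hleft hmulA' hleft' y y' hyy'
    haveI : IsIso (Base F₁ φ) := hφ.2
    haveI : IsIso (Base F₁ φ') := hφ'.2
    -- the common multiple `m := Div φ · Div φ'`, written as a pull-back along `φ` and along `φ'`
    have hmφ : pull Φ₁ (Base F₁ φ) (invDiv F₁ φ hφ.2 * pull Φ₁ (inv (Base F₁ φ)) (Div F₁ φ')) =
        Div F₁ φ * Div F₁ φ' := by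
      rw [map_mul, pull_invDiv, ← pull_comp, IsIso.hom_inv_id, pull_id]
    have hmφ' : pull Φ₁ (Base F₁ φ') (pull Φ₁ (inv (Base F₁ φ')) (Div F₁ φ) * invDiv F₁ φ' hφ'.2) =
        Div F₁ φ * Div F₁ φ' := by
      rw [map_mul, pull_invDiv, ← pull_comp, IsIso.hom_inv_id, pull_id]
    -- `T_X(m)` two ways
    have hTm : pull Φ₂ (Base F₂ (G.map φ))
          (T A (invDiv F₁ φ hφ.2 * pull Φ₁ (inv (Base F₁ φ)) (Div F₁ φ'))) =
        pull Φ₂ (Base F₂ (G.map φ'))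
          (T A' (pull Φ₁ (inv (Base F₁ φ')) (Div F₁ φ) * invDiv F₁ φ' hφ'.2)) := by
      rw [← step φ hφ hmulA hleft _ (Or.inr (hmφ ▸ dvd_mul_right _ _)),
        ← step φ' hφ' hmulA' hleft' _ (Or.inr (hmφ' ▸ dvd_mul_left _ _)), hmφ, hmφ']
    -- `T_X(m · u)` two ways, `u := φ^* y = φ'^* y'`
    have hTmu : pull Φ₂ (Base F₂ (G.map φ))
          (T A (invDiv F₁ φ hφ.2 * pull Φ₁ (inv (Base F₁ φ)) (Div F₁ φ') * y)) =
        pull Φ₂ (Base F₂ (G.map φ'))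
          (T A' (pull Φ₁ (inv (Base F₁ φ')) (Div F₁ φ) * invDiv F₁ φ' hφ'.2 * y')) := by
      have h1 : pull Φ₁ (Base F₁ φ) (invDiv F₁ φ hφ.2 * pull Φ₁ (inv (Base F₁ φ)) (Div F₁ φ') * y) =
          Div F₁ φ * Div F₁ φ' * pull Φ₁ (Base F₁ φ) y := by rw [map_mul, hmφ]
      have h2 : pull Φ₁ (Base F₁ φ')
          (pull Φ₁ (inv (Base F₁ φ')) (Div F₁ φ) * invDiv F₁ φ' hφ'.2 * y') =
          Div F₁ φ * Div F₁ φ' * pull Φ₁ (Base F₁ φ) y := by rw [map_mul, hmφ', hyy']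
      rw [← step φ hφ hmulA hleft _ (Or.inr (h1 ▸ dvd_mul_of_dvd_left (dvd_mul_right _ _) _)),
        ← step φ' hφ' hmulA' hleft' _ (Or.inr (h2 ▸ dvd_mul_of_dvd_left (dvd_mul_left _ _) _)),
        h1, h2]
    rw [hmulA (invDiv F₁ φ hφ.2 * pull Φ₁ (inv (Base F₁ φ)) (Div F₁ φ')) y,
      hmulA' (pull Φ₁ (inv (Base F₁ φ')) (Div F₁ φ) * invDiv F₁ φ' hφ'.2) y', map_mul, map_mul,
      hTm] at hTmu
    exact mul_left_cancel hTmu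
  -- (3) conclusion
  intro a b
  obtain ⟨A, φ, hφ, hmulA, hleft, hca⟩ := hcover a
  obtain ⟨A', φ', hφ', hmulA', hleft', hcb⟩ := hcover b
  obtain ⟨A'', φ'', hφ'', hmulA'', hleft'', hcab⟩ := hcover (a * b)
  haveI : IsIso (Base F₁ φ) := hφ.2
  haveI : IsIso (Base F₁ φ') := hφ'.2
  haveI : IsIso (Base F₁ φ'') := hφ''.2
  have hsurj : ∀ {A₀ : C₁} (φ₀ : X ⟶ A₀) [IsIso (Base F₁ φ₀)] (w : Φ₁.obj (op (baseObj F₁ X))),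
      pull Φ₁ (Base F₁ φ₀) (pull Φ₁ (inv (Base F₁ φ₀)) w) = w := by
    intro A₀ φ₀ _ w
    rw [← pull_comp, IsIso.hom_inv_id, pull_id]
  -- `T_X a`, `T_X b`, `T_X (ab)` as transports along `φ''`
  have ha : T X a = pull Φ₂ (Base F₂ (G.map φ'')) (T A'' (pull Φ₁ (inv (Base F₁ φ'')) a)) := by
    rw [← agree φ hφ φ'' hφ'' hmulA hleft hmulA'' hleft'' (pull Φ₁ (inv (Base F₁ φ)) a)
      (pull Φ₁ (inv (Base F₁ φ'')) a) (by rw [hsurj, hsurj]),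
      ← step φ hφ hmulA hleft _ (by rw [hsurj]; exact hca), hsurj]
  have hb : T X b = pull Φ₂ (Base F₂ (G.map φ'')) (T A'' (pull Φ₁ (inv (Base F₁ φ'')) b)) := by
    rw [← agree φ' hφ' φ'' hφ'' hmulA' hleft' hmulA'' hleft'' (pull Φ₁ (inv (Base F₁ φ')) b)
      (pull Φ₁ (inv (Base F₁ φ'')) b) (by rw [hsurj, hsurj]),
      ← step φ' hφ' hmulA' hleft' _ (by rw [hsurj]; exact hcb), hsurj]
  have hab : T X (a * b) =
      pull Φ₂ (Base F₂ (G.map φ'')) (T A'' (pull Φ₁ (inv (Base F₁ φ'')) (a * b))) := by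
    rw [← step φ'' hφ'' hmulA'' hleft'' _ (by rw [hsurj]; exact hcab), hsurj]
  rw [ha, hb, hab, map_mul, hmulA'', map_mul]

/-- **Descent along pull-back morphisms** (p. 89 ll. 41–46: "the right-hand and left-hand isomorphisms …
are clearly compatible with pull-back morphisms [Prop. 1.11 (v)] … we may assume without loss of
generality that `A` is strictly rational"). For a functor `G` carrying pull-back morphisms to pull-back
morphisms and pre-steps to pre-steps and a family of functions `T_A` with the pre-step clause: if
`α : A' → A` is a pull-back morphism and `T_{A'}` is multiplicative, then `T_A` is multiplicative —
`T` is natural along `α` (`pull_natural_of_isPullbackMorphism`) and `Base(Gα)^*` is injective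
(Def. 1.1 (ii)(a)). With `C₁` of rational type every object receives a pull-back morphism from a strictly
rational object (Def. 4.5 (ii)). [cite: MochizukiFrdI2008, Thm. 4.9 p.89] -/
theorem divTransport_mul_of_pullback_source (hF₁ : IsFrobenioid F₁) (hF₂ : IsFrobenioid F₂)
    (G : C₁ ⥤ C₂)
    (hGpb : ∀ ⦃X Y : C₁⦄ (φ : X ⟶ Y), IsPullbackMorphism F₁ φ → IsPullbackMorphism F₂ (G.map φ))
    (T : ∀ A : C₁, Φ₁.obj (op (baseObj F₁ A)) → Φ₂.obj (op (baseObj F₂ (G.obj A))))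
    (hT : ∀ ⦃A B : C₁⦄ (φ : A ⟶ B), IsPreStep F₁ φ → T A (Div F₁ φ) = Div F₂ (G.map φ))
    {A' A : C₁} (α : A' ⟶ A) (hα : IsPullbackMorphism F₁ α)
    (hmul : ∀ a b, T A' (a * b) = T A' a * T A' b) (y y' : Φ₁.obj (op (baseObj F₁ A))) :
    T A (y * y') = T A y * T A y' := by
  have hnat := pull_natural_of_isPullbackMorphism hF₁ hF₂ G hGpb T (fun A B φ hφ => hT φ hφ.2) α hα
  apply (hF₂.isPreFrobenioid.isMonoidOn.isCharInjective (Base F₂ (G.map α))).1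
  rw [map_mul, ← hnat, ← hnat, ← hnat, map_mul, hmul]

/-! ### Right-hand = left-hand propagates with multiplicativity (appended, v2)

The "right-hand = left-hand" hypothesis used by the backward comparisons holds automatically for
pre-steps out of multiplicative sources, and propagates to comparably covered objects — so
"multiplicative + right-hand = left-hand for all incoming pre-steps" is a closure system generated by
the universally Div-Frobenius-trivial objects (where it is the hypothesis of row T49-L02). -/

/-- **Right-hand = left-hand is automatic for pre-steps out of a multiplicative source.** If
`ζ : Z → Y` is a pre-step and `T_Z` is multiplicative, then `(Gζ)^* T_Y(x_ζ) = Div(Gζ)`: naturality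
along `ζ` (`divTransport_pull_eq_of_mul_source`) at `x_ζ`, `ζ^* x_ζ = Div ζ`, and the clause at `Z`.
[cite: MochizukiFrdI2008, Thm. 4.9 p.89] -/
theorem divTransport_left_eq_of_mul_source (hF₁ : IsFrobenioid F₁) (hF₂ : IsFrobenioid F₂)
    (G : C₁ ⥤ C₂) (hG : ∀ ⦃X Y : C₁⦄ (φ : X ⟶ Y), IsPreStep F₁ φ → IsPreStep F₂ (G.map φ))
    (T : ∀ A : C₁, Φ₁.obj (op (baseObj F₁ A)) → Φ₂.obj (op (baseObj F₂ (G.obj A))))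
    (hT : ∀ ⦃A B : C₁⦄ (φ : A ⟶ B), IsPreStep F₁ φ → T A (Div F₁ φ) = Div F₂ (G.map φ))
    {Z Y : C₁} (ζ : Z ⟶ Y) (hζ : IsPreStep F₁ ζ) (hmul : ∀ a b, T Z (a * b) = T Z a * T Z b) :
    pull Φ₂ (Base F₂ (G.map ζ)) (T Y (invDiv F₁ ζ hζ.2)) = Div F₂ (G.map ζ) := by
  rw [← divTransport_pull_eq_of_mul_source hF₁ hF₂ G hG T hT ζ hζ hmul, pull_invDiv, hT ζ hζ]

/-- **Right-hand = left-hand propagates to comparably covered objects.** Under the hypotheses of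
`divTransport_mul_of_cover` at `X`, right-hand = left-hand holds at `X` for EVERY pre-step
`ζ : Z → X` into `X`: `(Gζ)^* T_X(x_ζ) = Div(Gζ)` — compare right-hand = left-hand at the target `A`
of the pre-step `φ : X → A` attached to `x_ζ`, for `φ` and for `φ ∘ ζ` (`x_{φ∘ζ} = x_φ · (φ^*)⁻¹ x_ζ`),
with `T_X(x_ζ) = (Gφ)^* T_A((φ^*)⁻¹ x_ζ)`. So "multiplicative with right-hand = left-hand" is closed
under comparable coverage. [cite: MochizukiFrdI2008, Thm. 4.9 p.89] -/
theorem divTransport_left_eq_of_cover (hF₁ : IsFrobenioid F₁) (hF₂ : IsFrobenioid F₂)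
    (histr₁ : IsOfIsotropicType F₁) (G : C₁ ⥤ C₂)
    (hG : ∀ ⦃X Y : C₁⦄ (φ : X ⟶ Y), IsPreStep F₁ φ → IsPreStep F₂ (G.map φ))
    (T : ∀ A : C₁, Φ₁.obj (op (baseObj F₁ A)) → Φ₂.obj (op (baseObj F₂ (G.obj A))))
    (hT : ∀ ⦃A B : C₁⦄ (φ : A ⟶ B), IsPreStep F₁ φ → T A (Div F₁ φ) = Div F₂ (G.map φ))
    (X : C₁)
    (hcover : ∀ w : Φ₁.obj (op (baseObj F₁ X)), ∃ (A : C₁) (φ : X ⟶ A) (_ : IsPreStep F₁ φ),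
      (∀ a b, T A (a * b) = T A a * T A b) ∧
      (∀ ⦃Y : C₁⦄ (ζ : Y ⟶ A) (hζ : IsPreStep F₁ ζ),
        pull Φ₂ (Base F₂ (G.map ζ)) (T A (invDiv F₁ ζ hζ.2)) = Div F₂ (G.map ζ)) ∧
      (w ∣ Div F₁ φ ∨ Div F₁ φ ∣ w))
    {Z : C₁} (ζ : Z ⟶ X) (hζ : IsPreStep F₁ ζ) :
    pull Φ₂ (Base F₂ (G.map ζ)) (T X (invDiv F₁ ζ hζ.2)) = Div F₂ (G.map ζ) := by
  haveI : IsCancelMul (Φ₂.obj (op (baseObj F₂ (G.obj Z)))) :=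
    isIntegral_iff_isCancelMul.mp (hF₂.isPreFrobenioid.isDivisorial _).isPreDivisorial.isIntegral
  obtain ⟨A, φ, hφ, hmulA, hleft, hcmp⟩ := hcover (invDiv F₁ ζ hζ.2)
  haveI : IsIso (Base F₁ φ) := hφ.2
  -- `x_ζ = φ^* y₀`
  have hy₀ : pull Φ₁ (Base F₁ φ) (pull Φ₁ (inv (Base F₁ φ)) (invDiv F₁ ζ hζ.2)) = invDiv F₁ ζ hζ.2 := by
    rw [← pull_comp, IsIso.hom_inv_id, pull_id]
  -- `T_X(x_ζ)` is the transported value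
  have hTX : T X (invDiv F₁ ζ hζ.2) =
      pull Φ₂ (Base F₂ (G.map φ)) (T A (pull Φ₁ (inv (Base F₁ φ)) (invDiv F₁ ζ hζ.2))) := by
    rcases hcmp with h | h
    · rw [← divTransport_pull_eq_of_dvd hF₁ hF₂ histr₁ G hG T hT φ hφ hmulA hleft _ (hy₀.symm ▸ h),
        hy₀]
    · rw [← divTransport_pull_eq_of_dvd' hF₁ G hG T hT φ hφ hmulA (hleft φ hφ) _ (hy₀.symm ▸ h), hy₀]
  -- `x_{φ ∘ ζ} = x_φ · y₀`
  have hζφ : IsPreStep F₁ (ζ ≫ φ) := IsPreStep.comp F₁ hζ hφ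
  have hinv : invDiv F₁ (ζ ≫ φ) hζφ.2 =
      invDiv F₁ φ hφ.2 * pull Φ₁ (inv (Base F₁ φ)) (invDiv F₁ ζ hζ.2) := by
    haveI : IsIso (Base F₁ (ζ ≫ φ)) := hζφ.2
    apply pull_injective_of_isIso Φ₁ (Base F₁ (ζ ≫ φ))
    rw [pull_invDiv, map_mul, pull_base_comp_invDiv ζ φ hφ.2, base_comp, pull_comp, hy₀, pull_invDiv,
      div_comp, show degFr F₁ φ = 1 from hφ.1, PNat.one_coe, pow_one]
  -- right-hand = left-hand at `A` for `φ ∘ ζ`, unfolded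
  have key := hleft (ζ ≫ φ) hζφ
  rw [hinv, hmulA, map_mul, G.map_comp, base_comp, pull_comp, pull_comp, hleft φ hφ, ← hTX, div_comp,
    show degFr F₂ (G.map φ) = 1 from (hG φ hφ).1, PNat.one_coe, pow_one] at key
  exact mul_left_cancel key

end PreFrobenioid

end Literature.AlgebraicGeometry.Frobenioids
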